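import Summits.BirchSwinnertonDyer.BirchSwinnertonDyer.Theorems.SignedBaseChangeAuxiliaryCurves
import Summits.BirchSwinnertonDyer.Rank1Residual.Partition.IrreducibleOverQuadraticField
import Literature.NumberTheory.EllipticCurves.BurungaleCastellaSkinner2025.GreenbergMuInvariantProofs
import Literature.NumberTheory.EllipticCurves.BurungaleCastellaSkinner2025.GreenbergMuInvariantGoodReduction
import Literature.NumberTheory.QuadraticFields.KroneckerSplitting
import HarnessLib

/-!
# K2R‴ `SignedLowerDescentFromCommonFrame` (crux stmt-BirchSwinnertonDyer-20213), registered stub (S1)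
# `stub_muZero` — the anticyclotomic `μ = 0` of the twist pair's Greenberg functions, PROVED MODULO ITS
# TWO PRINTED INPUTS and the (disc) clauses the package does not carry (finding F4)

Route-independent `Theorems` file (no `Theses` import) of the cell `bsd-wall`, seat `bsd-wall-sbc-p2`
(prover; skeleton v5 of the crux K2R‴, evidence on stmt-BirchSwinnertonDyer-20213).

Stub (S1) asks, for the K1′ package data `(K, p = v v̄, κ₁, κ₂, f, f' = f_{W'}, W' ≅ W^{(d)}, …)` of route
`SignedBaseChange` and ANY common Katz frame `(Ω, δ, Ω_p, L_K)` carrying Greenberg functions `G` of `f`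
and `G'` of `f'` in the sound value frame `IsGreenbergLFunctionAnyRoot₂`, that the anticyclotomic
projections `G⁻ = G(T₁ = 0)` and `G'⁻` (`UnrSeries₂.minus`) have unit content. In print this is the last
paragraph of the proof of Thm. (KoMC'_lb) of Burungale–Skinner–Tian–Wan (arXiv:2409.01350v2, corpus
`paper:arxiv-2409.01350` p0076: «the `μ`-invariant of the BDP `p`-adic `L`-function vanishes [Bu] under
(indef), and the argument in the preceding paragraph applies»), i.e. two inputs:

* (H) **Hsieh 2014 Thm. B** — `μ(L_p^BDP(f/K)) = 0` under (Heeg), (spl), (disc), (irr_K): TYPED and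
  refereed, `BurungaleCastellaSkinner2025.prop422_exists_isBDPLFunction_mu_eq_zero` (good reduction at
  `p > 2`, NO ordinarity binder);
* (C) **the comparison `(G⁻) = (L_p^BDP)`** as ideals of `𝒪_{ℂ_p}⟦T⟧` — typed ONLY at ordinary `p`
  (`YanZhu2026.prop314_span_minus_eq_span_bdp_anyRoot` = CGS25 Prop. 2.4.5, under `GreenbergSetting`);
  at a SUPERSINGULAR `p` it is BSTW Prop. (GRL=BDPL)/(ii)-ss («The image of `𝓛_p^Gr(g/L)` modulo
  `γ_+ − 1` equals `−𝓛_v^BDP(g/L)`», corpus p0057), a PREPRINT statement with no tree binder yet.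

This file does NOT assert (C). It proves, in the kernel:

* §1 `hasUnitContent_minus_of_prop422_of_comparison` — for ONE newform `f = f_W`: granted (H) BY NAME and
  (C) as an explicit hypothesis on `G` (spelled in the currency of `prop314_…_anyRoot`'s conclusion:
  `G⁻` generates the same ideal as every BDP function `L` of `f` at the plain generator `γ₂`, read along a
  structure-compatible `J₀ : R₀ → 𝒪_{ℂ_p}`), under `2 < p`, GOOD reduction, `K` imaginary quadratic with
  (Heeg), (spl), (disc) and (irr_K): `HasUnitContent (minus G)` — the replay of
  `BurungaleCastellaSkinner2025.hasUnitContent_minus_of_prop314AnyRoot_of_prop422` with the ordinarity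
  binder gone (it was idle in that proof: only the comparison carried it).
* §2 `satisfiesHeegnerHypothesis_twist` — the Heegner hypothesis for the conductor `N'` of the admissible
  twist `W' ≅ W^{(d)}` from the package clauses «every `ℓ ∣ N`, every `ℓ ∣ d` and `2` split in `K`»
  (a bad prime of `W'` divides `d`, is `2`, or is a bad prime of `W`).
* §3 `stub_muZero_of_prop422_of_comparison_of_disc` — the PAIR statement in the exact binder shape of the
  registered stub (S1), with THREE extra hypotheses inserted: (C) for `(f, G)` and for `(f', G')`, and the
  (disc) clauses `Odd (NumberField.discr K)`, `NumberField.discr K ≠ -3` that (H) needs and the K1′/K2R‴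
  package does NOT carry (prover finding F4, cell STATUS 2026-08-27). Consequently (S1) as registered is
  closable BY NAME exactly when (i) a binder for (C) at supersingular `p` is typed and (ii) the package
  gains (disc) (free on the `∃ K` side) — nothing else: good reduction of `W'` at `p`, `Surj` for `W'`,
  (irr_K) for `W` and `W'` (`Rank1Residual.irrK_of_surj`) and (Heeg) for `N'` are all discharged here.

References: [BurungaleSkinnerTianWan2024] arXiv:2409.01350v2, proof of Thm. (KoMC'_lb) (corpus p0075–76),
Prop. (GRL=BDPL)-ss and §5.6.3 (i) (corpus p0055, p0057); [BurungaleCastellaSkinner2025] Prop. 4.2.2;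
[Hsieh2014] Thm. B; [YanZhu2024MainConjNonCM] Prop. 3.14; [SilvermanAEC2009] VII.5 Prop. 5.1 (twists).
-/

set_option autoImplicit false

noncomputable section

open scoped Classical

open CongruenceSubgroup WeierstrassCurve NumberField IsDedekindDomain Field
  Literature.NumberTheory.EllipticCurves Literature.NumberTheory.EllipticCurves.ModularForms
  Literature.NumberTheory.EllipticCurves.Rank1Residual
  Literature.NumberTheory.EllipticCurves.BurungaleSkinnerTianWan2024
  Literature.NumberTheory.EllipticCurves.BurungaleCastellaSkinner2025
  Literature.NumberTheory.EllipticCurves.GreenbergVatsal2000 Literature.NumberTheory.EllipticCurves.UnrSeries₂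

namespace Summit.BirchSwinnertonDyer.BirchSwinnertonDyer.Theorems.SignedBaseChangeK2RMuZero

/-! ## §1. One newform: `μ(G⁻) = 0` from Hsieh's `μ(L^BDP) = 0` and the comparison `(G⁻) = (L^BDP)` -/

/-- **`μ(𝓛_p^Gr(f/K)⁻) = 0` at any GOOD prime `p > 2`, granted Hsieh's `μ(L_p^BDP) = 0` BY NAME and the
comparison `(G⁻) = (L_p^BDP)` as a hypothesis on `G`.** For `E = W/ℚ` elliptic with newform `f` of level
`N`, `K` imaginary quadratic with (Heeg) for `N`, `p = v v̄` split, `D_K` odd and `≠ −3`, `E[p]|_{G_K}`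
irreducible, `v` the prime of `ι`, `κ₂` anticyclotomic with topological generator `γ₂`: if the
anticyclotomic projection `G⁻` of a series `G ∈ 𝒪_{ℂ_p}⟦T₂⟧⟦T₁⟧` generates the same ideal of `𝒪_{ℂ_p}⟦T⟧`
as every BDP function `L` of `f` (frame `IsBDPLFunction ι v κ₂ γ₂ f Ω_K Ω_p' L`, read along any
structure-compatible `J₀`), then `G⁻` has unit content. The replay of BCS Prop. 4.2.2's printed proof
(«By [Hsi14, Thm. B], `L_p^BDP` has vanishing `μ`-invariant. Since … the projection of `L_p^Gr` …
generates the same ideal as `L_p^BDP`, the result follows») with NO ordinarity binder.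
[cite: BurungaleCastellaSkinner2025, Prop. 4.2.2 and its proof (§4.2, pp. 8–9 of arXiv:2405.00270v2)]
[cite: BurungaleSkinnerTianWan2024, proof of Thm. (KoMC'_lb), last paragraph (corpus paper:arxiv-2409.01350 p0076)] -/
theorem hasUnitContent_minus_of_prop422_of_comparison
    (h422 : prop422_exists_isBDPLFunction_mu_eq_zero) {p : ℕ} [Fact p.Prime]
    (ι : PadicAlgCl p ≃+* ℂ) (W : WeierstrassCurve ℚ) [W.IsElliptic] (K : Type) [Field K] [NumberField K]
    (v : HeightOneSpectrum (𝓞 K)) (κ₂ : ZpExtension K p) (γ₂ : absoluteGaloisGroup K)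
    {N : ℕ} [NeZero N] {f : CuspForm (Gamma0 N) 2} (hf : IsNewformOf W f)
    (hp : 2 < p) (hgood : W.HasGoodReductionAtPrime p) (hK : IsImaginaryQuadratic K)
    (hHeeg : SatisfiesHeegnerHypothesis N K)
    (hsplit : ((Ideal.span {(p : ℤ)}).primesOver (𝓞 K)).ncard = 2)
    (hodd : Odd (NumberField.discr K)) (hne3 : NumberField.discr K ≠ -3)
    (hirrK : (W.baseChange K).HasIrreducibleModPGaloisRep p)
    (hv : ((p : ℕ) : 𝓞 K) ∈ v.asIdeal)
    (hιv : ∀ (w : InfinitePlace K) (k : 𝓞 K), k ∈ v.asIdeal ↔ ‖ι.symm (w.embedding (k : K))‖ < 1)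
    (hκ₂ : κ₂.IsAnticyclotomic) (hγ₂ : κ₂.IsTopGenerator γ₂)
    {G : PowerSeries (PowerSeries (PadicComplexInt p))}
    (hcmp : ∀ (ΩK : ℂ) (Ωp' : (unrIntegers p)ˣ) (L : UnrSeries p), ΩK ≠ 0 →
      IsBDPLFunction ι v κ₂ γ₂ f ΩK ((Ωp' : unrIntegers p) : ℂ_[p]) L →
      ∀ (J₀ : unrIntegers p →+* PadicComplexInt p),
        (∀ x : unrIntegers p, ((J₀ x : PadicComplexInt p) : ℂ_[p]) = (x : ℂ_[p])) →
        Ideal.span {minus G} = Ideal.span {PowerSeries.map J₀ L}) :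
    HasUnitContent (minus G) := by
  -- (H) Hsieh's frame at the plain anticyclotomic generator `γ₂`, with a unit coefficient
  obtain ⟨ΩK, Ωp', L, hΩK, hBDP, k, hk⟩ :=
    h422 ι W K v κ₂ γ₂ hf hp hgood hK hHeeg hsplit hodd hne3 hirrK hv hιv hκ₂ hγ₂
  -- a structure map `J₀ : R₀ → 𝒪_{ℂ_p}`
  obtain ⟨J₀, hJ₀⟩ := exists_ringHom_unrIntegers_padicComplexInt (p := p)
  -- (C) the comparison, then transport the unit coefficient
  exact HasUnitContent.of_span_singleton_eq (hcmp ΩK Ωp' L hΩK hBDP J₀ hJ₀) (HasUnitContent.map J₀ ⟨k, hk⟩)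

/-! ## §2. The Heegner hypothesis for the conductor of the admissible twist -/

/-- **(Heeg) for `N' = N_{W'}` from the package clauses.** If `C • W' = W^{(d)}` and every prime dividing
`N = N_W`, every prime dividing `d`, and `2` split in `K`, then every prime dividing `N'` splits in `K`: a
prime `q ∣ N'` is a bad prime of `W'`; if `q ∣ d` or `q = 2` it splits by hypothesis, and otherwise
`q ∤ 2d`, so good reduction of `W` at `q` would pass to `W'`
(`Rank1Residual.Supersingular.hasGoodReductionAtPrime_of_smul_eq_quadraticTwist`) — hence `q ∣ N`.
[cite: SilvermanAEC2009, VII.5 Prop. 5.1(a)] [cite: GrossZagier1986, §I.1 (Heegner hypothesis)] -/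
theorem satisfiesHeegnerHypothesis_twist (W W' : WeierstrassCurve ℚ) [W.IsElliptic] [W.IsGloballyMinimal]
    [W'.IsElliptic] [W'.IsGloballyMinimal] {d : ℤ} {C : VariableChange ℚ}
    (hC : C • W' = W.quadraticTwist (d : ℚ)) {N N' : ℕ} (hN : (N : ℤ) = W.conductorNorm ℤ)
    (hN' : (N' : ℤ) = W'.conductorNorm ℤ) (K : Type) [Field K] [NumberField K]
    (hHN : SatisfiesHeegnerHypothesis N K)
    (hd : ∀ ℓ : ℕ, ℓ.Prime → (ℓ : ℤ) ∣ d → ((Ideal.span {(ℓ : ℤ)}).primesOver (𝓞 K)).ncard = 2)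
    (h2 : ((Ideal.span {(2 : ℤ)}).primesOver (𝓞 K)).ncard = 2) :
    SatisfiesHeegnerHypothesis N' K := by
  have hNn : N = W.conductorNorm ℤ := by exact_mod_cast hN
  have hN'n : N' = W'.conductorNorm ℤ := by exact_mod_cast hN'
  intro q hq hqN'
  haveI : Fact q.Prime := ⟨hq⟩
  have hbad : ¬ W'.HasGoodReductionAtPrime q :=
    (W'.dvd_conductorNorm_iff_not_hasGoodReductionAtPrime q).mp (hN'n ▸ hqN')
  by_cases hqd : (q : ℤ) ∣ d
  · exact hd q hq hqd
  by_cases hq2 : q = 2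
  · subst hq2
    simpa using h2
  -- `q` odd and `q ∤ d`: `q ∤ 2d`, so `q` is a bad prime of `W`
  have hq2d : ¬ (q : ℤ) ∣ 2 * d := by
    intro h
    rcases (Nat.prime_iff_prime_int.mp hq).dvd_or_dvd h with h' | h'
    · have : q ∣ 2 := by exact_mod_cast h'
      exact hq2 ((Nat.prime_dvd_prime_iff_eq hq Nat.prime_two).mp this)
    · exact hqd h'
  have hbadW : ¬ W.HasGoodReductionAtPrime q := fun hg ↦ hbad
    (Summit.BirchSwinnertonDyer.Rank1Residual.Supersingular.hasGoodReductionAtPrime_of_smul_eq_quadraticTwist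
      W W' q hC hq2d hg)
  exact hHN q hq (hNn ▸ (W.dvd_conductorNorm_iff_not_hasGoodReductionAtPrime q).mpr hbadW)

/-! ## §3. The pair: registered stub (S1) modulo (C) ×2 and (disc) -/

/-- **Stub (S1) `stub_muZero` of K2R‴ modulo its printed inputs**: the registered binder shape of (S1)
VERBATIM (package clauses c1–c21 of `SignedLowerDescentFromCommonFrame` unpacked, then the common frame),
with three hypotheses inserted before the conclusion — the comparison (C) for `(f, G)` and for `(f', G')`
in the currency of `YanZhu2026.prop314_span_minus_eq_span_bdp_anyRoot`'s conclusion, and the (disc) clauses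
`Odd (NumberField.discr K)`, `NumberField.discr K ≠ -3` (ABSENT from the package: finding F4) — and
Hsieh's `μ(L^BDP) = 0` (`prop422_…`) granted BY NAME: then `μ(G⁻) = μ(G'⁻) = 0`. Everything else (S1)
needs is discharged: `2 < p` from `5 ≤ p`; good reduction of `W` (ClassX7) and of `W'`
(`Supersingular.hasGoodReductionAtPrime_of_smul_eq_quadraticTwist`, `p ∤ 2d`); (irr_K) for `W` and `W'`
from `Surj` over `ℚ` (`Rank1Residual.irrK_of_surj`, `Surj W' p` by `…AuxiliaryCurves.goodSS_surj_of_smul_eq_quadraticTwist`);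
(Heeg) for `N` = clause c16 and for `N'` = §2; `κ₂.IsTopGenerator γ₂` from the generator pair.
[cite: BurungaleSkinnerTianWan2024, proof of Thm. (KoMC'_lb), last paragraph (corpus paper:arxiv-2409.01350 p0076)]
[cite: BurungaleCastellaSkinner2025, Prop. 4.2.2 (§4.2, pp. 8–9 of arXiv:2405.00270v2)] -/
theorem stub_muZero_of_prop422_of_comparison_of_disc (h422 : prop422_exists_isBDPLFunction_mu_eq_zero) :
    ∀ (W : WeierstrassCurve ℚ) [W.IsElliptic] [W.IsGloballyMinimal] (p : ℕ) [Fact p.Prime], 5 ≤ p →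
    ClassX7 W p → Surj W p →
    ∀ (K : Type) [Field K] [NumberField K] (ι : PadicAlgCl p ≃+* ℂ) (v vbar : IsDedekindDomain.HeightOneSpectrum (NumberField.RingOfIntegers K)) (κ₁ κ₂ : Literature.NumberTheory.EllipticCurves.ZpExtension K p) (γ₁ γ₂ : Field.absoluteGaloisGroup K) [Fact (Literature.NumberTheory.EllipticCurves.ZpExtension.IsTopGeneratorPair κ₁ κ₂ γ₁ γ₂)] [NeZero (NumberField.discr K).natAbs] (N : ℕ) [NeZero N] (f : CuspForm (CongruenceSubgroup.Gamma0 N) 2) (d : ℤ) (W' : WeierstrassCurve ℚ) [W'.IsElliptic] [W'.IsGloballyMinimal] (C : WeierstrassCurve.VariableChange ℚ) (N' : ℕ) [NeZero N'] (f' : CuspForm (CongruenceSubgroup.Gamma0 N') 2),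
    (Literature.NumberTheory.EllipticCurves.ModularForms.IsNewformOf W f) →
    ((N : ℤ) = W.conductorNorm ℤ) →
    (Literature.NumberTheory.EllipticCurves.ModularForms.IsNewformOf W' f') →
    ((N' : ℤ) = W'.conductorNorm ℤ) →
    (Squarefree d) →
    (1 < d) →
    (∀ q : ℕ, q.Prime → Literature.NumberTheory.EllipticCurves.BurungaleSkinnerTianWan2024.RamifiedInQuadratic d q → q ≠ p ∧ ¬ q ∣ N ∧ ¬ (q : ℤ) ∣ NumberField.discr K) →
    (C • W' = W.quadraticTwist (d : ℚ)) →
    (Literature.NumberTheory.EllipticCurves.IsImaginaryQuadratic K) →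
    (((Ideal.span {(p : ℤ)}).primesOver (NumberField.RingOfIntegers K)).ncard = 2) →
    (((p : ℕ) : NumberField.RingOfIntegers K) ∈ v.asIdeal) →
    (((p : ℕ) : NumberField.RingOfIntegers K) ∈ vbar.asIdeal) →
    (vbar ≠ v) →
    (∀ (w : NumberField.InfinitePlace K) (k : NumberField.RingOfIntegers K), k ∈ v.asIdeal ↔ ‖ι.symm (w.embedding (k : K))‖ < 1) →
    (IsCoprime (N : ℤ) (NumberField.discr K)) →
    (∀ ℓ : ℕ, ℓ.Prime → ℓ ∣ N → ((Ideal.span {(ℓ : ℤ)}).primesOver (NumberField.RingOfIntegers K)).ncard = 2) →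
    (∀ ℓ : ℕ, ℓ.Prime → (ℓ : ℤ) ∣ d → ((Ideal.span {(ℓ : ℤ)}).primesOver (NumberField.RingOfIntegers K)).ncard = 2) →
    (((Ideal.span {(2 : ℤ)}).primesOver (NumberField.RingOfIntegers K)).ncard = 2) →
    (∀ ρ : Literature.NumberTheory.GaloisRepresentations.ModPGaloisRep K (ZMod p) 2, (W.baseChange K).IsTorsionGaloisRep p ρ → Literature.NumberTheory.GaloisRepresentations.FramedRep.IsAbsolutelyIrreducible ρ) →
    (κ₁.IsCyclotomic) →
    (κ₂.IsAnticyclotomic) →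
    ∀ (Ω δ : ℂ) (Ωp : (Literature.NumberTheory.EllipticCurves.unrIntegers p)ˣ)
      (LK G G' : PowerSeries (PowerSeries (PadicComplexInt p))),
      Ω ≠ 0 → (δ ^ 2 = (NumberField.discr K : ℂ) ∨ δ ^ 2 = -(NumberField.discr K : ℂ)) →
      Literature.NumberTheory.EllipticCurves.IsKatzMeasure₂ ι v vbar ∅ κ₁ κ₂ γ₁⁻¹ γ₂⁻¹ 1 Ω δ
        ((Ωp : Literature.NumberTheory.EllipticCurves.unrIntegers p) : PadicComplex p) LK →
      Literature.NumberTheory.EllipticCurves.IsGreenbergLFunctionAnyRoot₂ ι v vbar κ₁ κ₂ γ₁⁻¹ γ₂⁻¹ f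
        (NumberField.discr K).natAbs (NumberField.classNumber K) LK G →
      Literature.NumberTheory.EllipticCurves.IsGreenbergLFunctionAnyRoot₂ ι v vbar κ₁ κ₂ γ₁⁻¹ γ₂⁻¹ f'
        (NumberField.discr K).natAbs (NumberField.classNumber K) LK G' →
      -- (C) for `(f, G)`
      (∀ (ΩK : ℂ) (Ωp' : (unrIntegers p)ˣ) (L : UnrSeries p), ΩK ≠ 0 →
        IsBDPLFunction ι v κ₂ γ₂ f ΩK ((Ωp' : unrIntegers p) : ℂ_[p]) L →
        ∀ (J₀ : unrIntegers p →+* PadicComplexInt p),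
          (∀ x : unrIntegers p, ((J₀ x : PadicComplexInt p) : ℂ_[p]) = (x : ℂ_[p])) →
          Ideal.span {minus G} = Ideal.span {PowerSeries.map J₀ L}) →
      -- (C) for `(f', G')`
      (∀ (ΩK : ℂ) (Ωp' : (unrIntegers p)ˣ) (L : UnrSeries p), ΩK ≠ 0 →
        IsBDPLFunction ι v κ₂ γ₂ f' ΩK ((Ωp' : unrIntegers p) : ℂ_[p]) L →
        ∀ (J₀ : unrIntegers p →+* PadicComplexInt p),
          (∀ x : unrIntegers p, ((J₀ x : PadicComplexInt p) : ℂ_[p]) = (x : ℂ_[p])) →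
          Ideal.span {minus G'} = Ideal.span {PowerSeries.map J₀ L}) →
      -- (disc), NOT in the package (F4)
      Odd (NumberField.discr K) → NumberField.discr K ≠ -3 →
      HasUnitContent (minus G) ∧ HasUnitContent (minus G') := by
  intro W _ _ p _ hp5 hX hs K _ _ ι v vbar κ₁ κ₂ γ₁ γ₂ hpair _ N _ f d W' _ _ C N' _ f'
    c1 c2 c3 c4 c5 c6 c7 c8 c9 c10 c11 c12 c13 c14 c15 c16 c17 c18 c19 c20 c21
    Ω δ Ωp LK G G' hΩ hδ hLK hG hG' hcmp hcmp' hodd hne3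
  have hpP : p.Prime := Fact.out
  have hp2 : p ≠ 2 := by omega
  have hp : 2 < p := by omega
  have hgood : W.HasGoodReductionAtPrime p := hX.1.1
  have hap : W.frobeniusTrace p = 0 :=
    Summit.BirchSwinnertonDyer.Rank1Residual.Supersingular.ClassX7.frobeniusTrace_eq_zero_of_five_le W p hp5 hX
  have hpd : ¬ (p : ℤ) ∣ d := fun h ↦ (c7 p hpP (Or.inl h)).1 rfl
  -- the twist: good supersingular at `p` with surjective `ρ̄`
  obtain ⟨hgood', -, hs'⟩ :=
    Summit.BirchSwinnertonDyer.BirchSwinnertonDyer.Theorems.SignedBaseChangeAuxiliaryCurves.goodSS_surj_of_smul_eq_quadraticTwist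
      W W' p hp2 c5 hpd c8 hgood hap hs
  -- (irr_K) for `W` and for `W'` from `Surj` over `ℚ`
  have hirr : (W.baseChange K).HasIrreducibleModPGaloisRep p :=
    Summit.BirchSwinnertonDyer.Rank1Residual.irrK_of_surj W p hs K c9.1
  have hirr' : (W'.baseChange K).HasIrreducibleModPGaloisRep p :=
    Summit.BirchSwinnertonDyer.Rank1Residual.irrK_of_surj W' p hs' K c9.1
  -- (Heeg) for `N` (= clause c16) and for `N'` (§2)
  have hHeeg : SatisfiesHeegnerHypothesis N K := c16
  have hHeeg' : SatisfiesHeegnerHypothesis N' K := satisfiesHeegnerHypothesis_twist W W' c8 c2 c4 K c16 c17 c18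
  have hγ₂ : κ₂.IsTopGenerator γ₂ := hpair.out.right
  exact ⟨hasUnitContent_minus_of_prop422_of_comparison h422 ι W K v κ₂ γ₂ c1 hp hgood c9 hHeeg c10 hodd hne3
      hirr c11 c14 c21 hγ₂ hcmp,
    hasUnitContent_minus_of_prop422_of_comparison h422 ι W' K v κ₂ γ₂ c3 hp hgood' c9 hHeeg' c10 hodd hne3
      hirr' c11 c14 c21 hγ₂ hcmp'⟩

/-! ## §4 (appended). (disc) is FREE from «2 splits in `K`», and (S1) closes BY NAME from ONE refereed
fact: BCS 2025 Prop. 4.2.2 (Gr-half, good reduction), `prop422_greenbergAnyRoot_hasUnitContent_minus`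

Correction of the finding F4 recorded in §3's docstring: the (disc) clauses are NOT missing from the
package — the package clause «`2` splits in `K`» (c18) forces `D_K ≡ 1 (mod 8)` (decomposition law at
`2`, `Literature.NumberTheory.QuadraticFields.Quadratic.ncard_primesOver_two_eq_two_iff`), hence `D_K` odd and
`D_K ≠ −3` (`−3 ≡ 5 (mod 8)`). And the comparison (C) need not be typed at supersingular `p`: the tree
carries BCS Prop. 4.2.2's `L_p^Gr` half at a prime of GOOD reduction (no ordinarity) as the guarded named
fact `BurungaleCastellaSkinner2025.prop422_greenbergAnyRoot_hasUnitContent_minus` (PUBLISHED, IMRN 2025;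
sources [Hsi14, Thm. B] + [CGS23, Prop. 1.4.5]), whose frame binders (`Ω ≠ 0`, `δ² = ±D_K`) are exactly
those of (S1). So the registered stub (S1) of K2R‴ is EXACTLY that one fact applied twice (to `f` and
to `f' = f_{W'}`), every side condition being discharged from the package. -/

/-- **(disc) from «`2` splits in `K`»**: for a quadratic field `K` in which `2` splits, `D_K ≡ 1 (mod 8)`,
so `D_K` is odd and `D_K ≠ −3`. [cite: Marcus2018, Ch. 3 Thm. 25 (decomposition law at 2)] -/
theorem odd_discr_and_discr_ne_neg_three_of_two_split (K : Type) [Field K] [NumberField K]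
    (h2 : Module.finrank ℚ K = 2)
    (hsplit2 : ((Ideal.span {(2 : ℤ)}).primesOver (NumberField.RingOfIntegers K)).ncard = 2) :
    Odd (NumberField.discr K) ∧ NumberField.discr K ≠ -3 := by
  have h8 : NumberField.discr K % 8 = 1 :=
    (Literature.NumberTheory.QuadraticFields.Quadratic.ncard_primesOver_two_eq_two_iff h2).mp hsplit2
  exact ⟨Int.odd_iff.mpr (by omega), by omega⟩

/-- **Registered stub (S1) `stub_muZero` of K2R‴, modulo ONE refereed named fact.** Granted BCS 2025
Prop. 4.2.2 (Gr-half at a prime of GOOD reduction, guarded frame form)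
`prop422_greenbergAnyRoot_hasUnitContent_minus` BY NAME, the statement of (S1) holds VERBATIM: for the
K1′/K2R‴ package data and ANY genuine common Katz frame `(Ω ≠ 0, δ² = ±D_K, Ω_p, L_K)` carrying
Greenberg functions `G` of `f` and `G'` of `f'`, `μ(G⁻) = μ(G'⁻) = 0`. All side conditions come from the
package: `2 < p` (from `5 ≤ p`), good reduction of `W` (ClassX7) and of `W'`, (Heeg) for `N` (c16) and for
`N'` (§2), (spl), (disc) (c18 via `odd_discr_and_discr_ne_neg_three_of_two_split`), `(N, D_K) = 1` (c15) and
`(N', D_K) = 1`, (irr_K) for `W`, `W'` from `Surj` over `ℚ`. CONDITIONAL on that one fact (an unproved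
refereed result: Hsieh 2014 Thm. B + the CGS comparison); nothing else.
[cite: BurungaleCastellaSkinner2025, Prop. 4.2.2 and its proof (§4.2, p. 9 of arXiv:2405.00270v2)]
[cite: BurungaleSkinnerTianWan2024, proof of Thm. (KoMC'_lb), last paragraph (corpus paper:arxiv-2409.01350 p0076)] -/
theorem stub_muZero_of_prop422GreenbergAnyRoot (h : prop422_greenbergAnyRoot_hasUnitContent_minus) :
    ∀ (W : WeierstrassCurve ℚ) [W.IsElliptic] [W.IsGloballyMinimal] (p : ℕ) [Fact p.Prime], 5 ≤ p →
    ClassX7 W p → Surj W p →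
    ∀ (K : Type) [Field K] [NumberField K] (ι : PadicAlgCl p ≃+* ℂ) (v vbar : IsDedekindDomain.HeightOneSpectrum (NumberField.RingOfIntegers K)) (κ₁ κ₂ : Literature.NumberTheory.EllipticCurves.ZpExtension K p) (γ₁ γ₂ : Field.absoluteGaloisGroup K) [Fact (Literature.NumberTheory.EllipticCurves.ZpExtension.IsTopGeneratorPair κ₁ κ₂ γ₁ γ₂)] [NeZero (NumberField.discr K).natAbs] (N : ℕ) [NeZero N] (f : CuspForm (CongruenceSubgroup.Gamma0 N) 2) (d : ℤ) (W' : WeierstrassCurve ℚ) [W'.IsElliptic] [W'.IsGloballyMinimal] (C : WeierstrassCurve.VariableChange ℚ) (N' : ℕ) [NeZero N'] (f' : CuspForm (CongruenceSubgroup.Gamma0 N') 2),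
    (Literature.NumberTheory.EllipticCurves.ModularForms.IsNewformOf W f) →
    ((N : ℤ) = W.conductorNorm ℤ) →
    (Literature.NumberTheory.EllipticCurves.ModularForms.IsNewformOf W' f') →
    ((N' : ℤ) = W'.conductorNorm ℤ) →
    (Squarefree d) →
    (1 < d) →
    (∀ q : ℕ, q.Prime → Literature.NumberTheory.EllipticCurves.BurungaleSkinnerTianWan2024.RamifiedInQuadratic d q → q ≠ p ∧ ¬ q ∣ N ∧ ¬ (q : ℤ) ∣ NumberField.discr K) →
    (C • W' = W.quadraticTwist (d : ℚ)) →
    (Literature.NumberTheory.EllipticCurves.IsImaginaryQuadratic K) →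
    (((Ideal.span {(p : ℤ)}).primesOver (NumberField.RingOfIntegers K)).ncard = 2) →
    (((p : ℕ) : NumberField.RingOfIntegers K) ∈ v.asIdeal) →
    (((p : ℕ) : NumberField.RingOfIntegers K) ∈ vbar.asIdeal) →
    (vbar ≠ v) →
    (∀ (w : NumberField.InfinitePlace K) (k : NumberField.RingOfIntegers K), k ∈ v.asIdeal ↔ ‖ι.symm (w.embedding (k : K))‖ < 1) →
    (IsCoprime (N : ℤ) (NumberField.discr K)) →
    (∀ ℓ : ℕ, ℓ.Prime → ℓ ∣ N → ((Ideal.span {(ℓ : ℤ)}).primesOver (NumberField.RingOfIntegers K)).ncard = 2) →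
    (∀ ℓ : ℕ, ℓ.Prime → (ℓ : ℤ) ∣ d → ((Ideal.span {(ℓ : ℤ)}).primesOver (NumberField.RingOfIntegers K)).ncard = 2) →
    (((Ideal.span {(2 : ℤ)}).primesOver (NumberField.RingOfIntegers K)).ncard = 2) →
    (∀ ρ : Literature.NumberTheory.GaloisRepresentations.ModPGaloisRep K (ZMod p) 2, (W.baseChange K).IsTorsionGaloisRep p ρ → Literature.NumberTheory.GaloisRepresentations.FramedRep.IsAbsolutelyIrreducible ρ) →
    (κ₁.IsCyclotomic) →
    (κ₂.IsAnticyclotomic) →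
    ∀ (Ω δ : ℂ) (Ωp : (Literature.NumberTheory.EllipticCurves.unrIntegers p)ˣ)
      (LK G G' : PowerSeries (PowerSeries (PadicComplexInt p))),
      Ω ≠ 0 → (δ ^ 2 = (NumberField.discr K : ℂ) ∨ δ ^ 2 = -(NumberField.discr K : ℂ)) →
      Literature.NumberTheory.EllipticCurves.IsKatzMeasure₂ ι v vbar ∅ κ₁ κ₂ γ₁⁻¹ γ₂⁻¹ 1 Ω δ
        ((Ωp : Literature.NumberTheory.EllipticCurves.unrIntegers p) : PadicComplex p) LK →
      Literature.NumberTheory.EllipticCurves.IsGreenbergLFunctionAnyRoot₂ ι v vbar κ₁ κ₂ γ₁⁻¹ γ₂⁻¹ f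
        (NumberField.discr K).natAbs (NumberField.classNumber K) LK G →
      Literature.NumberTheory.EllipticCurves.IsGreenbergLFunctionAnyRoot₂ ι v vbar κ₁ κ₂ γ₁⁻¹ γ₂⁻¹ f'
        (NumberField.discr K).natAbs (NumberField.classNumber K) LK G' →
      HasUnitContent (minus G) ∧ HasUnitContent (minus G') := by
  intro W _ _ p _ hp5 hX hs K _ _ ι v vbar κ₁ κ₂ γ₁ γ₂ hpair _ N _ f d W' _ _ C N' _ f'
    c1 c2 c3 c4 c5 c6 c7 c8 c9 c10 c11 c12 c13 c14 c15 c16 c17 c18 c19 c20 c21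
    Ω δ Ωp LK G G' hΩ hδ hLK hG hG'
  have hpP : p.Prime := Fact.out
  have hp2 : p ≠ 2 := by omega
  have hp : 2 < p := by omega
  have hgood : W.HasGoodReductionAtPrime p := hX.1.1
  have hap : W.frobeniusTrace p = 0 :=
    Summit.BirchSwinnertonDyer.Rank1Residual.Supersingular.ClassX7.frobeniusTrace_eq_zero_of_five_le W p hp5 hX
  have hpd : ¬ (p : ℤ) ∣ d := fun h ↦ (c7 p hpP (Or.inl h)).1 rfl
  -- the twist: good supersingular at `p` with surjective `ρ̄`
  obtain ⟨hgood', -, hs'⟩ :=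
    Summit.BirchSwinnertonDyer.BirchSwinnertonDyer.Theorems.SignedBaseChangeAuxiliaryCurves.goodSS_surj_of_smul_eq_quadraticTwist
      W W' p hp2 c5 hpd c8 hgood hap hs
  -- (irr_K) for `W` and for `W'` from `Surj` over `ℚ`
  have hirr : (W.baseChange K).HasIrreducibleModPGaloisRep p :=
    Summit.BirchSwinnertonDyer.Rank1Residual.irrK_of_surj W p hs K c9.1
  have hirr' : (W'.baseChange K).HasIrreducibleModPGaloisRep p :=
    Summit.BirchSwinnertonDyer.Rank1Residual.irrK_of_surj W' p hs' K c9.1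
  -- (Heeg) for `N` and `N'`; `(N', D_K) = 1`
  have hHeeg' : SatisfiesHeegnerHypothesis N' K := satisfiesHeegnerHypothesis_twist W W' c8 c2 c4 K c16 c17 c18
  have hND' : IsCoprime (N' : ℤ) (NumberField.discr K) := by
    have hN'n : N' = W'.conductorNorm ℤ := by exact_mod_cast c4
    rw [Int.isCoprime_iff_gcd_eq_one, Int.gcd_eq_natAbs, Int.natAbs_natCast]
    refine Nat.coprime_of_dvd fun q hq hqN' hqD ↦ ?_
    -- `q ∣ N'` splits in `K` (Heegner for `N'`), while `q ∣ D_K` ramifies: `(D_K / q)`-count mismatch at `q`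
    have hsplit : ((Ideal.span {(q : ℤ)}).primesOver (NumberField.RingOfIntegers K)).ncard = 2 := hHeeg' q hq hqN'
    have hqD' : (q : ℤ) ∣ NumberField.discr K := Int.ofNat_dvd_left.mpr hqD
    rcases eq_or_ne q 2 with rfl | hq2
    · have h8 : NumberField.discr K % 8 = 1 :=
        (Literature.NumberTheory.QuadraticFields.Quadratic.ncard_primesOver_two_eq_two_iff c9.1).mp c18
      omega
    · haveI : Fact q.Prime := ⟨hq⟩
      have hj := (Literature.NumberTheory.QuadraticFields.Quadratic.ncard_primesOver_eq_two_iff_jacobiSym c9.1 hq hq2).mp hsplit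
      rw [jacobiSym.mod_left, Int.emod_eq_zero_of_dvd hqD', jacobiSym.zero_left hq.one_lt] at hj
      exact absurd hj (by decide)
  -- (disc) from «2 splits in K»
  obtain ⟨hodd, hne3⟩ := odd_discr_and_discr_ne_neg_three_of_two_split K c9.1 c18
  exact ⟨h ι W K v vbar κ₁ κ₂ γ₁ γ₂ c1 c2 hp hgood c9 c16 c10 hodd hne3 c15 hirr c11 c12 c13 c14 c20 c21
      Ω δ Ωp LK G hΩ hδ hLK hG,
    h ι W' K v vbar κ₁ κ₂ γ₁ γ₂ c3 c4 hp hgood' c9 hHeeg' c10 hodd hne3 hND' hirr' c11 c12 c13 c14 c20 c21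
      Ω δ Ωp LK G' hΩ hδ hLK hG'⟩

end Summit.BirchSwinnertonDyer.BirchSwinnertonDyer.Theorems.SignedBaseChangeK2RMuZero

end
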